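import Mathlib
import Literature.Analysis.Fourier.HilbertTransformLineL2
import HarnessLib

/-!
# The line Hilbert transform is skew-adjoint on `L²`: `∫ (Hf)·g = −∫ f·(Hg)`

`Literature/Analysis/Fourier`. For real `f, g ∈ L¹(ℝ) ∩ L²(ℝ)` whose symmetric p.v. integrands are integrable on `(0,∞)`
at a.e. point, the pointwise Hilbert transform `hilbertTransform` of `HilbertTransformLine.lean` satisfies

  `∫ (Hf)(x) g(x) dx = −∫ f(x) (Hg)(x) dx`     (`integral_hilbertTransform_mul_eq_neg`)

[cite: Grafakos2014, §5.1.1, text after eq. (5.1.15) («H* = −H. Likewise, we obtain Hᵗ = −H»)]. PROOF: each truncation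
`H_{ε,R}` (`hilbertTransformTrunc`) is skew-adjoint by Fubini over `ℝ × (ε,R)` and the substitutions `x ↦ x ± t`
(`integral_hilbertTransformTrunc_mul_eq_neg`, no Fourier analysis); then `H_{1/(n+1),n+1} f → Hf` in `L²`
(`tendsto_eLpNorm_hilbertTransformTrunc_sub`) and Cauchy–Schwarz pass to the limit on both sides. No definitions.
MOTIVATION (cell ns-blowup, zone Z3, case Z3-SR-CERT): the `w`-adjoint formulas of the certificate chain
(`HOME/profile/cert/impl1/SHEET-R-PRICE-impl1.md` (C2): `(Ω̄H)†φ = −w⁻¹H(wΩ̄φ)`, `(Ω̄′𝒰)†φ = −w⁻¹H(M_φ)`) and the FEM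
twin's entry formula (`SHEET-R-FRAME-NOTE-v2` (9d)) rest on exactly this antisymmetry. WHAT THIS IS NOT: not Navier–Stokes.
-/

namespace Literature.Analysis.Fourier

open _root_.MeasureTheory Set Filter
open scoped Real Topology ENNReal

/-! ### Skew-adjointness of the truncations (Fubini) -/

/-- Joint integrability of `(x,t) ↦ ((f(x−t) − f(x+t))/t)·g(x)` on `ℝ × (ε,R)` for `f ∈ L¹ ∩ L²`, `g ∈ L²`, `ε > 0`
(pointwise `|ab| ≤ (a² + b²)/2`, translation invariance, finite window). [folklore] -/
private theorem integrable_prod_symmIntegrand_mul {f g : ℝ → ℝ} (hf : Integrable f) (hf2 : MemLp f 2)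
    (hg2 : MemLp g 2) {ε R : ℝ} (hε : 0 < ε) :
    Integrable (fun p : ℝ × ℝ => (f (p.1 - p.2) - f (p.1 + p.2)) / p.2 * g p.1)
      ((volume : Measure ℝ).prod (volume.restrict (Ioo ε R))) := by
  have hF := integrable_prod_symmIntegrand hf hε (R := R)
  have hG : AEStronglyMeasurable (fun p : ℝ × ℝ => g p.1) ((volume : Measure ℝ).prod (volume.restrict (Ioo ε R))) :=
    hg2.1.comp_quasiMeasurePreserving Measure.quasiMeasurePreserving_fst
  have hmeas : AEStronglyMeasurable (fun p : ℝ × ℝ => (f (p.1 - p.2) - f (p.1 + p.2)) / p.2 * g p.1)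
      ((volume : Measure ℝ).prod (volume.restrict (Ioo ε R))) := hF.aestronglyMeasurable.mul hG
  rw [integrable_prod_iff' hmeas]
  -- the two translates of `f` are in `L²`
  have hA2 : ∀ t : ℝ, MemLp (fun x => f (x - t)) 2 := fun t =>
    hf2.comp_measurePreserving (measurePreserving_sub_right volume t)
  have hB2 : ∀ t : ℝ, MemLp (fun x => f (x + t)) 2 := fun t =>
    hf2.comp_measurePreserving (measurePreserving_add_right volume t)
  constructor
  · refine ae_of_all _ fun t => ?_
    have h := (((hA2 t).sub (hB2 t)).integrable_mul hg2).div_const t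
    refine h.congr (ae_of_all _ fun x => ?_)
    simp only [Pi.mul_apply, Pi.sub_apply]
    ring
  · -- `t ↦ ∫ |…| dx` is bounded by `(2‖f‖₂² + ‖g‖₂²)/ε` on the window
    have hfsq : Integrable (fun x => f x ^ 2) := hf2.integrable_sq
    have hgsq : Integrable (fun x => g x ^ 2) := hg2.integrable_sq
    set C : ℝ := ((∫ x, f x ^ 2) + (∫ x, f x ^ 2) + ∫ x, g x ^ 2) / ε with hC
    have hms : AEStronglyMeasurable (fun t => ∫ x, ‖(f (x - t) - f (x + t)) / t * g x‖)
        (volume.restrict (Ioo ε R)) := (hmeas.prod_swap.norm).integral_prod_right'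
    have hconst : IntegrableOn (fun _ : ℝ => C) (Ioo ε R) := (integrableOn_const_iff).2 (Or.inr measure_Ioo_lt_top)
    refine Integrable.mono' hconst hms ?_
    rw [ae_restrict_iff' measurableSet_Ioo]
    refine ae_of_all _ fun t ht => ?_
    have ht0 : 0 < t := hε.trans ht.1
    rw [Real.norm_eq_abs, abs_of_nonneg (integral_nonneg fun x => norm_nonneg _)]
    -- pointwise: `|(a − b)/t · g| ≤ (a² + b² + g²)/ε`
    have hpt : ∀ x, ‖(f (x - t) - f (x + t)) / t * g x‖ ≤
        (f (x - t) ^ 2 + f (x + t) ^ 2 + g x ^ 2) / ε := by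
      intro x
      rw [Real.norm_eq_abs, abs_mul, abs_div, abs_of_pos ht0, div_mul_eq_mul_div, div_le_div_iff₀ ht0 hε]
      have h1 : |f (x - t) - f (x + t)| * |g x| * ε ≤ |f (x - t) - f (x + t)| * |g x| * t := by
        gcongr; exact ht.1.le
      refine h1.trans ?_
      have h2 : |f (x - t) - f (x + t)| ≤ |f (x - t)| + |f (x + t)| := abs_sub _ _
      have h3 : |f (x - t) - f (x + t)| * |g x| ≤ f (x - t) ^ 2 + f (x + t) ^ 2 + g x ^ 2 := by
        have h4 := mul_le_mul_of_nonneg_right h2 (abs_nonneg (g x))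
        nlinarith [sq_nonneg (|f (x - t)| - |g x|), sq_nonneg (|f (x + t)| - |g x|), sq_abs (f (x - t)),
          sq_abs (f (x + t)), sq_abs (g x), abs_nonneg (g x), abs_nonneg (f (x - t)), abs_nonneg (f (x + t))]
      exact mul_le_mul_of_nonneg_right h3 ht0.le
    have ia : Integrable (fun x => f (x - t) ^ 2) := hfsq.comp_sub_right t
    have ib : Integrable (fun x => f (x + t) ^ 2) := hfsq.comp_add_right t
    have iab : Integrable (fun x => f (x - t) ^ 2 + f (x + t) ^ 2) := ia.add ib
    have hbound : Integrable (fun x => (f (x - t) ^ 2 + f (x + t) ^ 2 + g x ^ 2) / ε) := (iab.add hgsq).div_const ε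
    calc ∫ x, ‖(f (x - t) - f (x + t)) / t * g x‖ ≤ ∫ x, (f (x - t) ^ 2 + f (x + t) ^ 2 + g x ^ 2) / ε :=
          integral_mono_of_nonneg (ae_of_all _ fun x => norm_nonneg _) hbound (ae_of_all _ hpt)
      _ = C := by
          rw [integral_div, integral_add iab hgsq, integral_add ia ib,
            integral_sub_right_eq_self (μ := (volume : Measure ℝ)) (fun x => f x ^ 2) t,
            integral_add_right_eq_self (μ := (volume : Measure ℝ)) (fun x => f x ^ 2) t]

/-- **Each truncation is skew-adjoint**: `∫ (H_{ε,R} f)·g = −∫ f·(H_{ε,R} g)` for real `f, g ∈ L¹ ∩ L²`, `ε > 0`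
(Fubini and `∫ f(x−t) g(x) dx = ∫ f(x) g(x+t) dx`). [cite: Grafakos2014, §5.1.1, text after eq. (5.1.15) (Hᵗ = −H)] -/
theorem integral_hilbertTransformTrunc_mul_eq_neg {f g : ℝ → ℝ} (hf : Integrable f) (hf2 : MemLp f 2)
    (hg : Integrable g) (hg2 : MemLp g 2) {ε R : ℝ} (hε : 0 < ε) :
    ∫ x, hilbertTransformTrunc ε R f x * g x = -∫ x, f x * hilbertTransformTrunc ε R g x := by
  have hFg := integrable_prod_symmIntegrand_mul hf hf2 hg2 hε (R := R)
  have hGf := integrable_prod_symmIntegrand_mul hg hg2 hf2 hε (R := R)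
  -- move `g(x)` (resp. `f(x)`) inside the `t`-integral and swap
  have hL : ∫ x, hilbertTransformTrunc ε R f x * g x =
      π⁻¹ * ∫ t in Ioo ε R, ∫ x, (f (x - t) - f (x + t)) / t * g x := by
    unfold hilbertTransformTrunc
    have e : ∀ x, π⁻¹ * (∫ t in Ioo ε R, (f (x - t) - f (x + t)) / t) * g x =
        π⁻¹ * ∫ t in Ioo ε R, (f (x - t) - f (x + t)) / t * g x := by
      intro x; rw [mul_assoc, ← integral_mul_const]
    simp_rw [e]
    rw [integral_const_mul, integral_integral_swap hFg]
  have hR : ∫ x, f x * hilbertTransformTrunc ε R g x =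
      π⁻¹ * ∫ t in Ioo ε R, ∫ x, (g (x - t) - g (x + t)) / t * f x := by
    unfold hilbertTransformTrunc
    have e : ∀ x, f x * (π⁻¹ * ∫ t in Ioo ε R, (g (x - t) - g (x + t)) / t) =
        π⁻¹ * ∫ t in Ioo ε R, (g (x - t) - g (x + t)) / t * f x := by
      intro x; rw [mul_left_comm, mul_comm (f x), ← integral_mul_const]
    simp_rw [e]
    rw [integral_const_mul, integral_integral_swap hGf]
  rw [hL, hR, ← mul_neg, ← integral_neg]
  congr 1
  refine setIntegral_congr_fun measurableSet_Ioo (fun t _ => ?_)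
  -- the inner identity: `∫ (f(x−t) − f(x+t)) g(x) = −∫ (g(x−t) − g(x+t)) f(x)`
  have i1 : ∫ x, f (x - t) * g x = ∫ x, f x * g (x + t) := by
    have := integral_sub_right_eq_self (μ := (volume : Measure ℝ)) (fun x => f x * g (x + t)) t
    simp only [sub_add_cancel] at this
    exact this
  have i2 : ∫ x, f (x + t) * g x = ∫ x, f x * g (x - t) := by
    have := integral_add_right_eq_self (μ := (volume : Measure ℝ)) (fun x => f x * g (x - t)) t
    simp only [add_sub_cancel_right] at this
    exact this
  have hA2 : MemLp (fun x => f (x - t)) 2 := hf2.comp_measurePreserving (measurePreserving_sub_right volume t)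
  have hB2 : MemLp (fun x => f (x + t)) 2 := hf2.comp_measurePreserving (measurePreserving_add_right volume t)
  have hC2 : MemLp (fun x => g (x - t)) 2 := hg2.comp_measurePreserving (measurePreserving_sub_right volume t)
  have hD2 : MemLp (fun x => g (x + t)) 2 := hg2.comp_measurePreserving (measurePreserving_add_right volume t)
  have j1 : Integrable (fun x => f (x - t) * g x) := hA2.integrable_mul hg2
  have j2 : Integrable (fun x => f (x + t) * g x) := hB2.integrable_mul hg2
  have j3 : Integrable (fun x => g (x - t) * f x) := hC2.integrable_mul hf2
  have j4 : Integrable (fun x => g (x + t) * f x) := hD2.integrable_mul hf2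
  have eL : ∫ x, (f (x - t) - f (x + t)) / t * g x = t⁻¹ * ((∫ x, f (x - t) * g x) - ∫ x, f (x + t) * g x) := by
    rw [← integral_sub j1 j2, ← integral_const_mul]
    refine integral_congr_ae (ae_of_all _ fun x => ?_)
    simp only; ring
  have eR : ∫ x, (g (x - t) - g (x + t)) / t * f x = t⁻¹ * ((∫ x, g (x - t) * f x) - ∫ x, g (x + t) * f x) := by
    rw [← integral_sub j3 j4, ← integral_const_mul]
    refine integral_congr_ae (ae_of_all _ fun x => ?_)
    simp only; ring
  rw [eL, eR, i1, i2]
  have k1 : ∫ x, g (x - t) * f x = ∫ x, f x * g (x - t) := by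
    refine integral_congr_ae (ae_of_all _ fun x => ?_); simp only; ring
  have k2 : ∫ x, g (x + t) * f x = ∫ x, f x * g (x + t) := by
    refine integral_congr_ae (ae_of_all _ fun x => ?_); simp only; ring
  rw [k1, k2]
  ring

/-! ### Passage to the limit -/

/-- If `‖u n − v‖_{L²} → 0` and `g ∈ L²` then `∫ (u n)·g → ∫ v·g` (Cauchy–Schwarz). [folklore] -/
private theorem tendsto_integral_mul_of_tendsto_eLpNorm {u : ℕ → ℝ → ℝ} {v g : ℝ → ℝ}
    (hu : ∀ n, MemLp (u n) 2) (hv : MemLp v 2) (hg : MemLp g 2)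
    (h : Tendsto (fun n => eLpNorm (fun x => u n x - v x) 2 volume) atTop (𝓝 0)) :
    Tendsto (fun n => ∫ x, u n x * g x) atTop (𝓝 (∫ x, v x * g x)) := by
  -- `∫ (u n − v)² → 0`
  have hsq : Tendsto (fun n => ∫ x, (u n x - v x) ^ 2) atTop (𝓝 0) := by
    have e : ∀ n, ∫ x, (u n x - v x) ^ 2 = (∫⁻ x, ‖u n x - v x‖ₑ ^ 2).toReal := by
      intro n
      have hm : MemLp (fun x => u n x - v x) 2 := (hu n).sub hv
      rw [integral_eq_lintegral_of_nonneg_ae (ae_of_all _ fun x => sq_nonneg _) hm.integrable_sq.aestronglyMeasurable]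
      congr 1
      refine lintegral_congr fun x => ?_
      rw [← ofReal_norm, Real.norm_eq_abs, ← ENNReal.ofReal_pow (abs_nonneg _), sq_abs]
    have hl : ∀ n, (eLpNorm (fun x => u n x - v x) 2 volume) ^ (2 : ℝ) = ∫⁻ x, ‖u n x - v x‖ₑ ^ 2 := by
      intro n
      rw [eLpNorm_eq_lintegral_rpow_enorm_toReal two_ne_zero ENNReal.ofNat_ne_top, ENNReal.toReal_ofNat,
        ← ENNReal.rpow_mul, show (1 / (2 : ℝ)) * 2 = 1 by norm_num, ENNReal.rpow_one]
      simp only [ENNReal.rpow_two]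
    simp_rw [e]
    have h2 : Tendsto (fun n => (eLpNorm (fun x => u n x - v x) 2 volume) ^ (2 : ℝ)) atTop (𝓝 0) := by
      have := ((ENNReal.continuous_rpow_const (y := (2 : ℝ))).tendsto (0 : ℝ≥0∞)).comp h
      rwa [ENNReal.zero_rpow_of_pos (by norm_num : (0 : ℝ) < 2)] at this
    have h2' : Tendsto (fun n => ∫⁻ x, ‖u n x - v x‖ₑ ^ 2) atTop (𝓝 0) := by
      simp only [hl] at h2; exact h2
    have h3 := (ENNReal.tendsto_toReal ENNReal.zero_ne_top).comp h2'
    rw [ENNReal.toReal_zero] at h3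
    exact h3
  -- Cauchy–Schwarz: `|∫ (u n − v) g| ≤ √(∫ (u n − v)²) √(∫ g²)`
  have hCS : ∀ n, |(∫ x, u n x * g x) - ∫ x, v x * g x| ≤
      Real.sqrt (∫ x, (u n x - v x) ^ 2) * Real.sqrt (∫ x, g x ^ 2) := by
    intro n
    have hm : MemLp (fun x => u n x - v x) 2 := (hu n).sub hv
    have i1 : Integrable (fun x => u n x * g x) := (hu n).integrable_mul hg
    have i2 : Integrable (fun x => v x * g x) := hv.integrable_mul hg
    rw [← integral_sub i1 i2]
    have e1 : (fun x => u n x * g x - v x * g x) = fun x => (u n x - v x) * g x := by funext x; ring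
    rw [e1]
    have h1 : |∫ x, (u n x - v x) * g x| ≤ ∫ x, ‖u n x - v x‖ * ‖g x‖ := by
      refine (abs_integral_le_integral_abs).trans (le_of_eq ?_)
      refine integral_congr_ae (ae_of_all _ fun x => ?_); simp only [abs_mul, Real.norm_eq_abs]
    refine h1.trans ?_
    have hmn : MemLp (fun x => ‖u n x - v x‖) (ENNReal.ofReal 2) volume := by
      rw [show ENNReal.ofReal 2 = 2 by simp]; exact hm.norm
    have hgn : MemLp (fun x => ‖g x‖) (ENNReal.ofReal 2) volume := by
      rw [show ENNReal.ofReal 2 = 2 by simp]; exact hg.norm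
    have h2 := integral_mul_le_Lp_mul_Lq_of_nonneg Real.HolderConjugate.two_two
      (ae_of_all _ fun x => norm_nonneg (u n x - v x)) (ae_of_all _ fun x => norm_nonneg (g x)) hmn hgn
    refine h2.trans (le_of_eq ?_)
    rw [Real.sqrt_eq_rpow, Real.sqrt_eq_rpow]
    congr 2
    · refine integral_congr_ae (ae_of_all _ fun x => ?_); simp only [Real.rpow_two, Real.norm_eq_abs, sq_abs]
    · refine integral_congr_ae (ae_of_all _ fun x => ?_); simp only [Real.rpow_two, Real.norm_eq_abs, sq_abs]
  rw [Metric.tendsto_atTop]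
  intro δ hδ
  have hlim : Tendsto (fun n => Real.sqrt (∫ x, (u n x - v x) ^ 2) * Real.sqrt (∫ x, g x ^ 2)) atTop (𝓝 0) := by
    have := ((Real.continuous_sqrt.tendsto 0).comp hsq).mul_const (Real.sqrt (∫ x, g x ^ 2))
    simpa using this
  rw [Metric.tendsto_atTop] at hlim
  obtain ⟨N, hN⟩ := hlim δ hδ
  refine ⟨N, fun n hn => ?_⟩
  have h := hN n hn
  rw [Real.dist_eq, sub_zero, abs_of_nonneg (by positivity)] at h
  rw [Real.dist_eq]
  exact (hCS n).trans_lt h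

/-- **The Hilbert transform is skew-adjoint on `L²`**: for real `f, g ∈ L¹ ∩ L²` whose symmetric p.v. integrands are
integrable on `(0,∞)` at a.e. point, `∫ (Hf)·g = −∫ f·(Hg)`.
[cite: Grafakos2014, §5.1.1, text after eq. (5.1.15) («H* = −H … Hᵗ = −H»)] -/
theorem integral_hilbertTransform_mul_eq_neg {f g : ℝ → ℝ} (hf : Integrable f) (hf2 : MemLp f 2)
    (hg : Integrable g) (hg2 : MemLp g 2)
    (hintf : ∀ᵐ x : ℝ, IntegrableOn (fun t => (f (x - t) - f (x + t)) / t) (Ioi 0))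
    (hintg : ∀ᵐ x : ℝ, IntegrableOn (fun t => (g (x - t) - g (x + t)) / t) (Ioi 0)) :
    ∫ x, hilbertTransform f x * g x = -∫ x, f x * hilbertTransform g x := by
  have hpos : ∀ n : ℕ, (0 : ℝ) < 1 / ((n : ℝ) + 1) := fun n => by positivity
  -- left side: `∫ (H_n f) g → ∫ (Hf) g`
  have hHf : MemLp (hilbertTransform f) 2 := memLp_two_hilbertTransform hf hf2 hintf
  have hHg : MemLp (hilbertTransform g) 2 := memLp_two_hilbertTransform hg hg2 hintg
  have hL : Tendsto (fun n : ℕ => ∫ x, hilbertTransformTrunc (1 / ((n : ℝ) + 1)) ((n : ℝ) + 1) f x * g x) atTop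
      (𝓝 (∫ x, hilbertTransform f x * g x)) :=
    tendsto_integral_mul_of_tendsto_eLpNorm (fun n => memLp_two_hilbertTransformTrunc hf hf2 (hpos n)) hHf hg2
      (tendsto_eLpNorm_hilbertTransformTrunc_sub hf hf2 hintf)
  -- right side: `∫ f (H_n g) → ∫ f (Hg)`
  have hR : Tendsto (fun n : ℕ => ∫ x, f x * hilbertTransformTrunc (1 / ((n : ℝ) + 1)) ((n : ℝ) + 1) g x) atTop
      (𝓝 (∫ x, f x * hilbertTransform g x)) := by
    have h := tendsto_integral_mul_of_tendsto_eLpNorm (fun n => memLp_two_hilbertTransformTrunc hg hg2 (hpos n))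
      hHg hf2 (tendsto_eLpNorm_hilbertTransformTrunc_sub hg hg2 hintg)
    have e1 : ∀ n : ℕ, ∫ x, hilbertTransformTrunc (1 / ((n : ℝ) + 1)) ((n : ℝ) + 1) g x * f x =
        ∫ x, f x * hilbertTransformTrunc (1 / ((n : ℝ) + 1)) ((n : ℝ) + 1) g x := fun n =>
      integral_congr_ae (ae_of_all _ fun x => mul_comm _ _)
    have e2 : ∫ x, hilbertTransform g x * f x = ∫ x, f x * hilbertTransform g x :=
      integral_congr_ae (ae_of_all _ fun x => mul_comm _ _)
    simp_rw [e1, e2] at h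
    exact h
  -- the truncations are skew-adjoint at every level
  have hn : ∀ n : ℕ, ∫ x, hilbertTransformTrunc (1 / ((n : ℝ) + 1)) ((n : ℝ) + 1) f x * g x =
      -∫ x, f x * hilbertTransformTrunc (1 / ((n : ℝ) + 1)) ((n : ℝ) + 1) g x := fun n =>
    integral_hilbertTransformTrunc_mul_eq_neg hf hf2 hg hg2 (hpos n)
  simp_rw [hn] at hL
  exact tendsto_nhds_unique hL hR.neg

end Literature.Analysis.Fourier
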